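import Literature.Analysis.FluidPDE.ForwardDSSLocalEnergyLimit
import Literature.Analysis.FluidPDE.ForwardDSSMollifiedDrift
import Literature.Analysis.FluidPDE.ForwardDSSPressureKernel
import Literature.Analysis.FluidPDE.ClassicalSuitable
import Literature.Analysis.FunctionSpaces.WeakLpLocal
import HarnessLib

/-!
# Forward DSS solutions: Bradshaw–Tsai 2019, Prop. 3.1 — the mollified approximants as a class,
  and the split "[BT1] scheme + a priori estimate (3.12)"

Analysis/FluidPDE fact file, fourth layer under the named fact
`Literature.Analysis.FluidPDE.bradshawTsai2019_prop_3_1` (Bradshaw–Tsai, Analysis & PDE 12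
(2019) = arXiv:1801.08060, Proposition 3.1; files `ForwardDSSExistence`,
`ForwardDSSExistenceLocal`, `ForwardDSSLocalEnergy`, `ForwardDSSLocalEnergyLimit`). The accepted
`ForwardDSSLocalEnergyLimit.lean` reduced Prop. 3.1 (indeed the fact
`bradshawTsai2019_prop_3_1_scheme` of `ForwardDSSLocalEnergy.lean`) to the single analytic input
`bradshawTsai2019_prop_3_1_approximation`, "whose remaining content is (a) the construction of
[BT1] (Thm 1.2 via Thm 2.4) *together with its approximants and their convergence* and (b) the a
priori estimate (3.12) with the pressure bound for the smooth approximants ((3.6)–(3.11):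
Gagliardo–Nirenberg, Young, Calderón–Zygmund, the pressure formula (3.8))". Parts (a) and (b) have
different sources ([BT1] = Bradshaw–Tsai, Ann. Henri Poincaré 18 (2017), proof of Thm 2.4 and §4,
*versus* arXiv:1801.08060 pp. 8–10) and different natures (a compactness construction *versus* an
estimate valid for every smooth solution of the mollified system), but in
`bradshawTsai2019_prop_3_1_approximation` they are entangled: (b) is asserted of the very objects
(a) produces. This file disentangles them by naming the class of objects p. 8–9 work with:

* the drift `(η_{ε√t} * v_ε)(x, t)` of the mollified Navier–Stokes system **(3.5)**
  `∂ₜv_ε − Δv_ε + (η_{ε√t} * v_ε)·∇v_ε + ∇π_ε = 0` is the accepted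
  `BradshawTsai2019.mollifiedDrift η ε w` of `ForwardDSSMollifiedDrift.lean` (with the scaled
  mollifiers `BradshawTsai2019.scaledMollifier η δ = η_δ`, the `λ`-DSS covariance of the drift and
  the local bound (3.10) proved there); nothing about it is redefined here;
* `BradshawTsai2019.IsMollifiedApproximant c ε η v₀ w ϖ` — **the printed properties of one
  approximant `(v_ε, π_ε)`** (pp. 8–9): `v_ε` is `λ`-DSS ((3.6)) and "smooth on `ℝ³ × (0,∞)`";
  `(v_ε, π_ε)` solves (3.5) (in `𝒟'((0,∞) × ℝ³)`, the rendering of the sibling predicate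
  `IsDistributionalNSSolutionOn` with the drift in the convective slot, `div v_ε = 0` weakly);
  "`v_ε(t) → v₀` in `L²_loc`" ("right continuous in `L²_loc` at `t = 0`"); the energy class
  `v_ε ∈ L²(0,T;H¹(K))` of the approximants (p. 8: the space in which "`v_ε → v` weakly in
  `L²(0,T;H¹(K))`" for all `T > 0` and compact `K`; recorded as `∫₀ᵀ∫_{B_R}|∇v_ε|² < ∞`); the
  **pressure formula (3.8)** of p. 9, `π_ε = −⅓[(η_{ε√t}*v_ε)·v_ε] + p.v.∫Kᵢⱼ(·−y)(η_{ε√t}*v_ε)ᵢ(v_ε)ⱼ dy`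
  a.e. on `(0,∞) × ℝ³` (the bilinear principal value `BradshawTsai2019.HasPressureFormPV` of the
  accepted `ForwardDSSPressureKernel.lean`, the form consumed by the proved pressure bound of
  `ForwardDSSPressureEstimate.lean`; "we can re-define `π_ε` to equal `π_ε − π_*(t)` and,
  therefore, can drop `π_*(t)` from (3.8)"); and the two global classes of p. 9:
  `G = (η_{ε√t} * v_ε) ⊗ v_ε ∈ L²(t₁,t₂;L²(ℝ³))` ("By Young's convolution inequality,
  `‖G‖_{L²(t₁,t₂;L²)} ≲ …`") and "The pressure `π_ε` given by (3.8) is already bounded in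
  `L²([t₁,t₂];L²(ℝ³))` for any `0 < t₁ < t₂ < ∞`" (see "Design notes");
* `bradshawTsai2019_mollifiedScheme` (named fact, **not proved**; part (a)): for `λ > 1` there is
  a mollifier `η` such that every divergence free `λ`-DSS `v₀ ∈ L³_w` has a [BT1] solution
  `(v, π)` (`λ`-DSS local Leray solution with `λ`-DSS pressure and a weak gradient) together with
  scales `ε_k → 0` and approximants `(v_{ε_k}, π_{ε_k})` in the class, converging to `(v, π)` in
  the three senses recorded by `bradshawTsai2019_prop_3_1_approximation` (p. 8 convergence list,
  p. 10, [BT1] proof of Thm 2.4);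
* `bradshawTsai2019_apriori_3_12` (named fact, **not proved**; part (b)): for `λ > 1` and a
  mollifier `η` there are `ε₀ = ε₀(λ, η) > 0` and `C₀ = C(λ, η, γ)` such that **every** member of
  the class with `0 < ε ≤ ε₀` obeys the local energy estimate **(3.12)** and the pressure bound of
  p. 10 on `0 < t ≤ 1` (clauses (ii)–(iii) of the approximation fact, with the classical gradient);
* **proved**: clause (i) of the approximation fact for members of the class —
  `IsMollifiedApproximant.continuousOn_ballEnergy` ("because each `v_ε` is smooth on
  `ℝ³ × (0,∞)` … `α_ε(t) = ∫_{B₁}|v_ε(x,t)|² dx` … [is] continuous", p. 8: dominated convergence on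
  the unit ball) and `IsMollifiedApproximant.tendsto_ballEnergy` (its right limit `∫_{B₁}|v₀|²` at
  `t = 0` from "`v_ε(t) → v₀` in `L²_loc`": Minkowski in `L²(B₁)`); the weak gradient of a member
  is its classical gradient (`IsMollifiedApproximant.hasWeakSpatialGradientOn`, the accepted
  `hasWeakSpatialGradientOn_of_contDiffOn`); non-vacuity of the class
  (`isMollifiedApproximant_zero`); and the **assembly**
  `bradshawTsai2019_prop_3_1_approximation_of_parts : (a) → (b) → approximation` (pass to the tail
  `ε_k ≤ ε₀` of the sequence — the convergences are tail-invariant — and quote (b) for each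
  approximant), whence `…_scheme_of_parts`, `…_dss_of_parts'`, `…_prop_3_1_of_parts'`.

Hence the trust base of Prop. 3.1 in the tree becomes
`{bradshawTsai2019_mollifiedScheme, bradshawTsai2019_apriori_3_12}`: a pure existence-and-
compactness statement about [BT1]'s construction, and a pure a priori estimate about smooth DSS
solutions of (3.5) with pressure (3.8), each attackable on its own. For the latter the tree
already proves: the scaling laws (3.6) (`ForwardDSSLocalEnergyScaling`), the mollifier bound
(3.10) (`ForwardDSSMollifiedDrift`), the cubic estimate (3.11) with Gagliardo–Nirenberg
(`ForwardDSSLocalEnergySobolev`, `ForwardDSSLocalEnergyCubic`, uniform constant in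
`ForwardDSSPressureEstimate`), the local energy equality (3.7) in test-function form for members
of the class (`ForwardDSSMollifiedSchemeEnergy`), and the three pressure bounds of p. 10 from (3.8)
by the proved Calderón–Zygmund theorem of the tree (`ForwardDSSPressureKernel`,
`ForwardDSSPressureLocalTerm`, `ForwardDSSPressureEstimate`); what remains of (b) is the sliced
form of (3.7) down to `t = 0` and the absorption/assembly of p. 10.

## Design notes

* *The class records BT2019's description of the scheme.* [BT1] (arXiv:1510.07504, (2.3) and the
  proof of Thm 2.4) mollifies only the perturbation: with `u_ε = U_ε + W` the nonlinearity of the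
  mollified perturbed Leray system is `(W + η_ε * U_ε)·∇U_ε + U_ε·∇W + W·∇W`, whereas Bradshaw–Tsai
  2019 quote the scheme as (3.4) `∂ₛu_ε − Δu_ε − ½u_ε − ½y·∇u_ε + (η_ε * u_ε)·∇u_ε + ∇p_ε = 0`
  (the full drift mollified, "this matches the mollification used in [Chae-Wolf]", p. 8) and work
  with its physical-variables form (3.5). The class and both facts render **(3.5) as printed in
  Bradshaw–Tsai 2019**; `bradshawTsai2019_mollifiedScheme` is cited to their p. 8 ("Since `v` is a
  solution from [BT1], … In particular, for each `ε > 0`, there exists a time periodic solution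
  `u_ε` to the problem (3.4)"), with [BT1] for the convergences.
* *The pressure formula (3.8) is a field of the class* (revision 2, D-0026 review of the split).
  The printed proof derives (3.8) for the scheme's approximants from the classes
  `w_ε = v_ε − e^{tΔ}v₀ ∈ L^∞(t₁,t₂;L²) ∩ L²(t₁,t₂;L⁶)`, `G ∈ L²(t₁,t₂;L²)`, the uniqueness theorem
  for the non-stationary Stokes system of [BT1], [CKN], and the normalisation
  `π_ε ↦ π_ε − π_*(t)` (p. 9) — an argument about *which* pressure the construction produces —
  and the estimates of p. 10 then *consume* (3.8): `π_ε(t) = −⅓ tr G(t) + p.v. K ∗ G(t)`. The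
  first rendering of this file recorded only the two printed `L²` classes of `G` and `π_ε`,
  observing that together with (3.5) they characterise (3.8) (for a.e. `t`, `π_ε(t) − RᵢRⱼGᵢⱼ(t)`
  is an `L²` harmonic function, hence zero), and left that derivation inside debt (b). It is
  true but it is not performed in the source, and in the tree it costs a distributional pressure
  equation for the drift system, a time slicing for the *bilinear* tensor `(η_{ε√t}*v_ε) ⊗ v_ε`,
  the `L²` theory of the bilinear Riesz transforms for non-decaying smooth data, Weyl's lemma and
  Liouville — none of which is part of the printed a priori estimate; its prove-seat sized (b)
  XL on exactly this account. The class therefore now records (3.8) itself, as p. 9 states it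
  for the approximants ("The pressure `π_ε` given by (3.8) …"), in the pointwise-a.e. form
  `∃ L, HasPressureFormPV (η_{ε√t}*v_ε)(t) (v_ε(t)) x L ∧ π_ε(t,x) = −⅓⟪(η_{ε√t}*v_ε), v_ε⟫(t,x) + L`
  for a.e. `(t,x) ∈ (0,∞) × ℝ³` (`ForwardDSSPressureKernel`; for smooth slices with
  `G(t) ∈ L²(ℝ³)` the principal value exists at every point, and Stein's theorem gives a.e.
  convergence in general, so "a.e." loses nothing), which is verbatim the hypothesis of the
  proved `BradshawTsai2019.exists_setLIntegral_cylinder_pressure_rpow_le`. The two printed `L²`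
  classes are kept (they are printed, and harmless). Effect on the two debts: (a) additionally
  asserts (3.8) of [BT1]'s approximants (printed, p. 9; and in [BT1], proof of Thm 2.4, the
  pressure of the regularised system is *replaced* by the Riesz-transform pressure
  `p̃_ε = ΣRᵢRⱼ(…)`: "We may therefore replace `p_ε` by `p̃_ε`"), (b) is the printed estimate; the
  Lean statements of both facts and the assembly are textually unchanged.
* *Why the dissipation class.* The absorption step of p. 9 ("Provided `γ` is small enough, the
  gradient term can be absorbed into the left hand side of (3.7)") and (3.7) itself with `∫₀ᵗ`
  presuppose `∫₀ᵗ∫|∇v_ε|²φ < ∞`. For [BT1]'s approximants this is their membership in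
  `L²(0,T;H¹(K))` (p. 8: "for all `T > 0` and all compact sets `K ⊂ ℝ³`, `v_ε → v` weakly in
  `L²(0,T;H¹(K))`"; [BT1]: `U_ε ∈ L²H¹` over a period). It is not available from the other fields
  by the printed argument: the re-scalings (3.6), (3.10)–(3.11) and the annuli `A_k` of `π_far`
  move every bound to *earlier* times (`t/λ²`, `tλ^{−2k}`), so an estimate on `[δ,t]` still
  involves the dissipation on `(0,t)`, and smoothness on the open slab says nothing as `t → 0⁺`.
  The class records it as `∫∫_{(0,T)×B_R}|∇v_ε|² < ∞` for all `T, R` (the `L²` part of the `H¹`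
  norm follows from `continuousOn_ballEnergy`, `tendsto_ballEnergy` and (3.6)).
* *Smoothness and the equation.* "Each `v_ε` is smooth on `ℝ³ × (0,∞)`" is `ContDiffOn ℝ ∞` of
  the uncurried field on the open slab; nothing is printed about the regularity of `π_ε`, so (3.5)
  is rendered distributionally on the slab (test class `IsSpaceTimeTestOn`, the conjuncts of
  `IsDistributionalNSSolutionOn` with `convect (η_{ε√t} * v_ε)` in place of `convect v_ε`, `ν = 1`,
  `f = 0`, the quadratic local-integrability clause being that of `|η_{ε√t} * v_ε| |v_ε|`; the
  local integrability of `v_ε` itself follows from smoothness and is not a field). The local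
  energy *equality* (3.7) is a consequence (smooth solutions), not a field.
* *`t ≤ 0`, DSS.* As in the sibling files, `λ`-DSS is the pointwise identity on `ℝ × ℝ³` (fields
  extended by `0` to `t ≤ 0`; no other clause sees `t ≤ 0`), and the datum is attained along
  `𝓝[>] 0` on compact sets.
* *Quantifiers.* [BT1] fix the mollifier once ("for some `η ∈ C₀^∞` satisfying `∫η = 1`";
  BT2019: "`η ∈ C₀^∞(ℝ³)`, is non-negative, and satisfies `∫η dy = 1`"), so (a) reads
  `∀ λ, ∃ η, ∀ v₀, …`; (b) holds for every such `η` with `ε₀ = ε₀(λ, η)` ("By taking `ε`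
  sufficiently small we can ensure that, whenever `s < 1`, `supp η_{ε√s} ⊂ B_{λ−1}`", p. 9) and
  `C₀ = C(λ, η, γ)` independent of `ε` and of the datum ((3.12)); the standing hypotheses of
  Prop. 3.1 on `v₀` are kept in (b) although only `α₀ = ‖v₀‖²_{L²(B_λ)}` enters. The assembly
  discards the finitely many `k` with `ε_k > ε₀`.

## Mathlib / tree search

Reused, nothing redefined: `bradshawTsai2019_prop_3_1_approximation/_scheme/_dss`, `ballEnergy`,
`supBallEnergy` and the proved lower layers (`ForwardDSSLocalEnergy*`); `IsLocalLeraySolution`,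
`IsSpaceTimeTestOn`, `timeDeriv`, `convect`, `VectorCalculus.divergence`, `frobeniusNormSq`,
`HasWeakSpatialGradientOn`, `slab` (`WeakSolution`, `SuitableWeak`, `VectorCalculus`);
`hasWeakSpatialGradientOn_of_contDiffOn` (`ClassicalSuitable`); `BradshawTsai2019.mollifiedDrift`,
`scaledMollifier` (`ForwardDSSMollifiedDrift`); `BradshawTsai2019.HasPressureFormPV`,
`hasPressureFormPV_zero_left` (`ForwardDSSPressureKernel`, the bilinear principal value of (3.8));
`MemWeakLp.setLIntegral_enorm_sq_lt_top_of_two_lt` (`WeakLpLocal`); Mathlib's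
`tendsto_lintegral_filter_of_dominated_convergence'`, `ENNReal.lintegral_Lp_add_le`.
`lean search 'IsMollifiedApproximant|apriori_3_12|mollifiedScheme'`: no prior rendering of the
class, of (3.5) as an equation, or of the two facts.

## References

* Z. Bradshaw, T.-P. Tsai, *Discretely self-similar solutions to the Navier–Stokes equations with
  data in `L²_loc` satisfying the local energy inequality*, Analysis & PDE 12 (2019) 1943–1962 =
  arXiv:1801.08060, §3: Prop. 3.1, (3.4)–(3.6) and the convergence list (p. 8), (3.7)–(3.11) and
  the classes of `w_ε`, `G`, `π_ε` (p. 9), the pressure bounds, (3.12)–(3.14) and the closing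
  paragraph (p. 10) [BradshawTsai2019].
* Z. Bradshaw, T.-P. Tsai, *Forward discretely self-similar solutions of the Navier–Stokes
  equations II*, Ann. Henri Poincaré 18 (2017) 1095–1119 = arXiv:1510.07504: (2.3), proof of
  Thm 2.4 (the mollifier `η_ε`, the sequence `ε_k → 0` and its convergences, `p_{ε_k} ⇀ p` in
  `L^{5/3}`), §4 [BradshawTsai2017AHP].
-/

noncomputable section

open MeasureTheory Set Function Filter Topology TopologicalSpace Metric
open scoped NNReal ENNReal RealInnerProductSpace ContDiff Laplacian

namespace Literature.Analysis.FluidPDE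

/-- Local notation for physical space `ℝ³ = EuclideanSpace ℝ (Fin 3)`. -/
local notation "ℝ³" => EuclideanSpace ℝ (Fin 3)

open BradshawTsai2019 FunctionSpaces

namespace BradshawTsai2019

/-! ## The class of approximants -/

/-- **One mollified approximant of Bradshaw–Tsai 2019, §3** (arXiv:1801.08060, pp. 8–9), for the
scaling factor `c = λ`, the scale `ε`, the mollifier `η`, the datum `v₀` and a pair
`(w, ϖ) = (v_ε, π_ε)`: the printed properties of the physical-variables image
`v_ε(x,t) = u_ε(y,s)/√t` of a time periodic solution `u_ε` of the mollified Leray system (3.4)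
("Since `v` is a solution from [BT1], its image under the similarity transform solves the
time-periodic Leray equations and is the limit of a mollified approximation scheme [BT1]. In
particular, for each `ε > 0`, there exists a time periodic solution `u_ε` to the problem (3.4) …
Applying [the similarity transform `v(x,t) = u(y,s)/√t`, `y = x/√t`, `s = log t`] we obtain a
`λ`-DSS vector field `v_ε` satisfying (3.5) `∂ₜv_ε − Δv_ε + (η_{ε√t} * v_ε)·∇v_ε + ∇π_ε = 0`"):
`v_ε` is `λ`-DSS (whence the scaling laws (3.6)); "each `v_ε` is smooth on `ℝ³ × (0,∞)`";
`(v_ε, π_ε)` solves (3.5) with `div v_ε = 0` in the sense of distributions on `(0,∞) × ℝ³`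
(`π_ε` and `|η_{ε√t} * v_ε| |v_ε|` locally integrable there, as in
`IsDistributionalNSSolutionOn`); "`v_ε(t) → v₀` in `L²_loc`, i.e. the mollification does not
affect the initial data", "right continuous in `L²_loc` at `t = 0`"; the energy class of the
approximants, `∫₀ᵀ∫_{B_R}|∇v_ε|² < ∞` for all `T, R` ("for all `T > 0` and all compact sets
`K ⊂ ℝ³`, `v_ε → v` weakly in `L²(0,T;H¹(K))`", p. 8 — the space the approximants lie in; see the
module docstring, "Why the dissipation class"); the **pressure formula (3.8)** (p. 9), "`π_ε(x,t) =
−⅓[(η_{ε√t}*v_ε)·v_ε](x,t) + lim_{δ→0}∫_{|y|>δ} Kᵢⱼ(x−y)(η_{ε√t}*v_ε)ᵢ(y,t)(v_ε)ⱼ(y,t) dy`, where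
`Kᵢⱼ(x) = ∂ᵢ∂ⱼ(4π|x|)⁻¹`" after the normalisation "we can re-define `π_ε` to equal `π_ε − π_*(t)`
and, therefore, can drop `π_*(t)` from (3.8)", for a.e. `(t,x) ∈ (0,∞) × ℝ³`, the limit being the
bilinear principal value `HasPressureFormPV` of `ForwardDSSPressureKernel`; and, for all
`0 < t₁ < t₂ < ∞`, `G = (η_{ε√t} * v_ε) ⊗ v_ε ∈ L²(t₁,t₂;L²(ℝ³))` ("By Young's convolution
inequality, `‖G‖_{L²(t₁,t₂;L²)} ≲ ‖η_{ε√t}‖_{L^∞(t₁,t₂;L^{6/5}∩L¹)}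
(‖w_ε‖_{L⁴(t₁,t₂;L³)} + ‖V₀‖_{L⁴})²`") and "The pressure `π_ε` given by (3.8) is already bounded in
`L²([t₁,t₂];L²(ℝ³))`" (see the module docstring, "The pressure formula (3.8) is a field of the
class"). [cite: BradshawTsai2019, §3 proof of Prop 3.1 (pp. 8–9: (3.5), (3.6), the energy class of p. 8, (3.8), classes of G and π_ε)] -/
structure IsMollifiedApproximant (c ε : ℝ) (η : ℝ³ → ℝ) (v₀ : ℝ³ → ℝ³) (w : ℝ → ℝ³ → ℝ³)
    (ϖ : ℝ → ℝ³ → ℝ) : Prop where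
  /-- `v_ε` is `λ`-DSS: `λ v_ε(λ²t, λx) = v_ε(t, x)` on `ℝ × ℝ³` ((3.6)). -/
  dss : IsDiscretelySelfSimilar c w
  /-- "each `v_ε` is smooth on `ℝ³ × (0,∞)`" (p. 8). -/
  smooth : ContDiffOn ℝ ∞ (uncurry w) (Ioi (0 : ℝ) ×ˢ (univ : Set ℝ³))
  /-- `π_ε ∈ L¹_loc((0,∞) × ℝ³)` (so that (3.5) makes sense in `𝒟'`). -/
  locallyIntegrableOn_pressure :
    LocallyIntegrableOn (uncurry ϖ) (Ioi (0 : ℝ) ×ˢ (univ : Set ℝ³)) volume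
  /-- `|η_{ε√t} * v_ε| |v_ε| ∈ L¹_loc((0,∞) × ℝ³)` (the quadratic term of (3.5) in `𝒟'`; the twin
  of the `|u|²` clause of `IsDistributionalNSSolutionOn`). -/
  locallyIntegrableOn_drift :
    LocallyIntegrableOn (fun z : ℝ × ℝ³ => ‖mollifiedDrift η ε w z.1 z.2‖ * ‖uncurry w z‖)
      (Ioi (0 : ℝ) ×ˢ (univ : Set ℝ³)) volume
  /-- `div v_ε = 0` weakly on `(0,∞) × ℝ³`: `∫∫ ⟪v_ε, ∇ₓθ⟫ = 0` for scalar tests `θ`. -/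
  divFree : ∀ θ : ℝ → ℝ³ → ℝ, IsSpaceTimeTestOn (slab ℝ³ (Ioi 0) isOpen_Ioi) θ →
    ∫ z in Ioi (0 : ℝ) ×ˢ (univ : Set ℝ³), ⟪w z.1 z.2, gradient (θ z.1) z.2⟫ = 0
  /-- **(3.5)** in `𝒟'((0,∞) × ℝ³)`: for every vector test field `ψ`,
  `∫∫ (⟪v_ε, ∂ₜψ⟫ + ⟪v_ε, ((η_{ε√t} * v_ε)·∇)ψ⟫ + ⟪v_ε, Δψ⟫ + π_ε div ψ) = 0`. -/
  momentum : ∀ ψ : ℝ → ℝ³ → ℝ³, IsSpaceTimeTestOn (slab ℝ³ (Ioi 0) isOpen_Ioi) ψ →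
    ∫ z in Ioi (0 : ℝ) ×ˢ (univ : Set ℝ³), (⟪w z.1 z.2, timeDeriv ψ z.1 z.2⟫ +
      ⟪w z.1 z.2, convect (mollifiedDrift η ε w z.1) (ψ z.1) z.2⟫ + ⟪w z.1 z.2, Δ (ψ z.1) z.2⟫ +
      ϖ z.1 z.2 * VectorCalculus.divergence (ψ z.1) z.2) = 0
  /-- "`v_ε(t) → v₀` in `L²_loc`": `∫_K |v_ε(t) − v₀|² → 0` as `t → 0⁺`, `K` compact. -/
  initial : ∀ K : Set ℝ³, IsCompact K →
    Tendsto (fun t => ∫⁻ x in K, ‖w t x - v₀ x‖ₑ ^ 2) (𝓝[>] 0) (𝓝 0)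
  /-- The energy class of the approximants, `v_ε ∈ L²(0,T;H¹(K))` (p. 8): the dissipation
  `∫₀ᵀ∫_{B_R} |∇v_ε|²` is finite for all `T, R` (classical gradient of the smooth field). -/
  dissipation : ∀ T R : ℝ,
    ∫⁻ z in Ioo 0 T ×ˢ ball (0 : ℝ³) R,
      ENNReal.ofReal (frobeniusNormSq (fderiv ℝ (w z.1) z.2)) < ⊤
  /-- **(3.8)** (p. 9), a.e. on `(0,∞) × ℝ³`: `π_ε(x,t) = −⅓⟪(η_{ε√t}*v_ε)(x,t), v_ε(x,t)⟫ + L` with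
  `L = lim_{δ→0⁺} ∫_{|x−y|>δ} Σᵢⱼ Kᵢⱼ(x−y)(η_{ε√t}*v_ε)ᵢ(y,t)(v_ε)ⱼ(y,t) dy` the bilinear principal
  value of the pressure kernel `Kᵢⱼ = ∂ᵢ∂ⱼ(4π|x|)⁻¹` (the normalised pressure, `π_*(t)` dropped). -/
  pressure_formula : ∀ᵐ z ∂(volume.restrict (Ioi (0 : ℝ) ×ˢ (univ : Set ℝ³))), ∃ L : ℝ,
    HasPressureFormPV (mollifiedDrift η ε w z.1) (w z.1) z.2 L ∧
      ϖ z.1 z.2 = -(1 / 3 : ℝ) * ⟪mollifiedDrift η ε w z.1 z.2, w z.1 z.2⟫ + L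
  /-- `G = (η_{ε√t} * v_ε) ⊗ v_ε ∈ L²((t₁,t₂) × ℝ³)` for `0 < t₁ < t₂` (`|a ⊗ b| = |a| |b|`). -/
  drift_sq : ∀ t₁ t₂ : ℝ, 0 < t₁ → t₁ < t₂ →
    ∫⁻ z in Ioo t₁ t₂ ×ˢ (univ : Set ℝ³),
      ‖mollifiedDrift η ε w z.1 z.2‖ₑ ^ 2 * ‖w z.1 z.2‖ₑ ^ 2 < ⊤
  /-- `π_ε ∈ L²((t₁,t₂) × ℝ³)` for `0 < t₁ < t₂` (the normalised pressure of (3.8)). -/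
  pressure_sq : ∀ t₁ t₂ : ℝ, 0 < t₁ → t₁ < t₂ →
    ∫⁻ z in Ioo t₁ t₂ ×ˢ (univ : Set ℝ³), ‖ϖ z.1 z.2‖ₑ ^ 2 < ⊤

/-- The mollified drift of the zero field vanishes. [folklore] -/
theorem mollifiedDrift_zero (η : ℝ³ → ℝ) (ε : ℝ) :
    mollifiedDrift η ε (0 : ℝ → ℝ³ → ℝ³) = 0 := by
  funext t x
  simp [mollifiedDrift_apply]

/-- **Non-vacuity.** For the zero datum the trivial pair `(0, 0)` is a mollified approximant for
every `λ`, `ε`, `η` (all integrands vanish; the principal value of the zero tensor is `0`). [folklore] -/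
theorem isMollifiedApproximant_zero (c ε : ℝ) (η : ℝ³ → ℝ) :
    IsMollifiedApproximant c ε η (0 : ℝ³ → ℝ³) (0 : ℝ → ℝ³ → ℝ³) (0 : ℝ → ℝ³ → ℝ) where
  dss := by funext t x; simp
  smooth := contDiffOn_const
  locallyIntegrableOn_pressure :=
    show LocallyIntegrableOn (fun _ : ℝ × ℝ³ => (0 : ℝ)) (Ioi (0 : ℝ) ×ˢ (univ : Set ℝ³)) volume
      from locallyIntegrableOn_const _
  locallyIntegrableOn_drift := by
    have h0 : (fun z : ℝ × ℝ³ => ‖mollifiedDrift η ε (0 : ℝ → ℝ³ → ℝ³) z.1 z.2‖ *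
        ‖uncurry (0 : ℝ → ℝ³ → ℝ³) z‖) = fun _ => 0 := by
      funext z; simp [uncurry_zero]
    rw [h0]
    exact locallyIntegrableOn_const _
  divFree θ _ := by simp
  momentum ψ _ := by simp
  initial K _ := by simp
  dissipation T R := by simp [frobeniusNormSq_zero]
  pressure_formula := by
    refine ae_of_all _ fun z => ⟨0, ?_, by simp⟩
    rw [mollifiedDrift_zero]
    exact hasPressureFormPV_zero_left _ _
  drift_sq t₁ t₂ _ _ := by simp
  pressure_sq t₁ t₂ _ _ := by
    simp only [Pi.zero_apply, enorm_zero, ne_eq, OfNat.ofNat_ne_zero, not_false_eq_true, zero_pow,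
      lintegral_const, zero_mul, ENNReal.zero_lt_top]

/-! ## Clause (i) of the approximation fact for members of the class -/

section Consequences

variable {c ε : ℝ} {η : ℝ³ → ℝ} {v₀ : ℝ³ → ℝ³} {w : ℝ → ℝ³ → ℝ³} {ϖ : ℝ → ℝ³ → ℝ}

/-- The slices `v_ε(t)`, `t > 0`, of a mollified approximant are continuous. [folklore] -/
theorem IsMollifiedApproximant.continuous_slice (h : IsMollifiedApproximant c ε η v₀ w ϖ) {t : ℝ}
    (ht : 0 < t) : Continuous (w t) :=
  (h.smooth.continuousOn.comp_continuous (continuous_const.prodMk continuous_id)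
    fun x => mk_mem_prod ht (mem_univ x) : _)

/-- **Continuity of the local energy of an approximant** (Bradshaw–Tsai 2019, p. 8: "because each
`v_ε` is smooth on `ℝ³ × (0,∞)` …, `α_ε(t) = ∫_{B₁}|v_ε(x,t)|² dx` … [is] continuous as [a]
function of `t`"): `t ↦ ∫_{B₁}|v_ε(t)|²` is continuous on `(0, ∞)` — near `t₀ > 0` the field is
bounded on `[t₀/2, 2t₀] × B̄₁`, so dominated convergence applies on the unit ball. [cite: BradshawTsai2019, §3 proof of Prop 3.1 (p. 8)] -/
theorem IsMollifiedApproximant.continuousOn_ballEnergy (h : IsMollifiedApproximant c ε η v₀ w ϖ) :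
    ContinuousOn (ballEnergy w) (Ioi 0) := by
  have hcont : ContinuousOn (uncurry w) (Ioi (0 : ℝ) ×ˢ (univ : Set ℝ³)) := h.smooth.continuousOn
  intro t₀ ht₀
  refine ContinuousAt.continuousWithinAt ?_
  have ht₀' : 0 < t₀ := ht₀
  -- a uniform bound on a compact space–time box around `{t₀} × B̄₁`
  have hK : IsCompact (Icc (t₀ / 2) (2 * t₀) ×ˢ closedBall (0 : ℝ³) 1) :=
    isCompact_Icc.prod (isCompact_closedBall _ _)
  have hKsub : Icc (t₀ / 2) (2 * t₀) ×ˢ closedBall (0 : ℝ³) 1 ⊆ Ioi (0 : ℝ) ×ˢ (univ : Set ℝ³) :=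
    Set.prod_mono (fun t ht => (half_pos ht₀').trans_le ht.1) (subset_univ _)
  obtain ⟨M, hM⟩ := hK.exists_bound_of_continuousOn (hcont.mono hKsub)
  have hbox : Icc (t₀ / 2) (2 * t₀) ∈ 𝓝 t₀ := Icc_mem_nhds (by linarith) (by linarith)
  refine tendsto_lintegral_filter_of_dominated_convergence' (fun _ => ENNReal.ofReal M ^ 2)
    ?_ ?_ ?_ ?_
  · filter_upwards [hbox] with t ht
    have ht0 : 0 < t := (half_pos ht₀').trans_le ht.1
    exact ((h.continuous_slice ht0).aestronglyMeasurable.enorm.pow_const 2)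
  · filter_upwards [hbox] with t ht
    rw [ae_restrict_iff' measurableSet_ball]
    refine ae_of_all _ fun x hx => ?_
    have hb := hM (t, x) ⟨ht, ball_subset_closedBall hx⟩
    have hb' : ‖w t x‖ₑ ≤ ENNReal.ofReal M := by
      rw [← ofReal_norm]
      exact ENNReal.ofReal_le_ofReal hb
    exact pow_le_pow_left' hb' 2
  · rw [setLIntegral_const]
    exact ENNReal.mul_ne_top (ENNReal.pow_ne_top ENNReal.ofReal_ne_top) measure_ball_lt_top.ne
  · refine ae_of_all _ fun x => ?_
    have hca : ContinuousAt (uncurry w) (t₀, x) :=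
      hcont.continuousAt (prod_mem_nhds (Ioi_mem_nhds ht₀') univ_mem)
    have hline : ContinuousAt (fun t => w t x) t₀ :=
      (hca.comp (f := fun t : ℝ => (t, x))
        (continuous_id.prodMk continuous_const).continuousAt : _)
    exact (ENNReal.continuous_pow 2).continuousAt.tendsto.comp hline.enorm

/-- Minkowski's inequality in `L²` for the square roots of lower Lebesgue integrals of squares:
if `f ≤ g + k` pointwise then `(∫ f²)^{1/2} ≤ (∫ g²)^{1/2} + (∫ k²)^{1/2}` (Mathlib's
`ENNReal.lintegral_Lp_add_le` with `p = 2`, natural-power form). [folklore] -/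
theorem sqrt_lintegral_sq_le_add {α : Type*} [MeasurableSpace α] {μ : Measure α}
    {f g k : α → ℝ≥0∞} (hg : AEMeasurable g μ) (hk : AEMeasurable k μ)
    (hle : ∀ x, f x ≤ g x + k x) :
    (∫⁻ x, f x ^ 2 ∂μ) ^ (1 / 2 : ℝ) ≤
      (∫⁻ x, g x ^ 2 ∂μ) ^ (1 / 2 : ℝ) + (∫⁻ x, k x ^ 2 ∂μ) ^ (1 / 2 : ℝ) := by
  have h2 := ENNReal.lintegral_Lp_add_le hg hk (one_le_two (α := ℝ))
  simp only [ENNReal.rpow_two, Pi.add_apply] at h2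
  refine le_trans (ENNReal.rpow_le_rpow (lintegral_mono fun x => ?_) (by norm_num)) h2
  exact pow_le_pow_left' (hle x) 2

/-- **The right limit of the local energy at `t = 0`** (Bradshaw–Tsai 2019, p. 8: "`v_ε(t) → v₀`
in `L²_loc`, i.e. the mollification does not affect the initial data", "right continuous in
`L²_loc` at `t = 0`"): if `∫_{B₁}|v₀|² < ∞` then `∫_{B₁}|v_ε(t)|² → ∫_{B₁}|v₀|²` as `t → 0⁺`
(Minkowski in `L²(B₁)`: `|‖v_ε(t)‖ − ‖v₀‖| ≤ ‖v_ε(t) − v₀‖ → 0`). [cite: BradshawTsai2019, §3 proof of Prop 3.1 (p. 8)] -/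
theorem IsMollifiedApproximant.tendsto_ballEnergy (h : IsMollifiedApproximant c ε η v₀ w ϖ)
    (hv₀ : AEStronglyMeasurable v₀ volume) (hfin : ∫⁻ x in ball (0 : ℝ³) 1, ‖v₀ x‖ₑ ^ 2 < ⊤) :
    Tendsto (ballEnergy w) (𝓝[>] 0) (𝓝 (∫⁻ x in ball (0 : ℝ³) 1, ‖v₀ x‖ₑ ^ 2)) := by
  set μ : Measure ℝ³ := volume.restrict (ball (0 : ℝ³) 1) with hμ
  -- the three quantities: `L t = ∫|w t|²`, `l = ∫|v₀|²`, `d t = ∫|w t - v₀|²`, all over `B₁`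
  set L : ℝ → ℝ≥0∞ := fun t => ∫⁻ x, ‖w t x‖ₑ ^ 2 ∂μ with hL
  set l : ℝ≥0∞ := ∫⁻ x, ‖v₀ x‖ₑ ^ 2 ∂μ with hl
  set d : ℝ → ℝ≥0∞ := fun t => ∫⁻ x, ‖w t x - v₀ x‖ₑ ^ 2 ∂μ with hd
  change Tendsto L (𝓝[>] 0) (𝓝 l)
  have hd0 : Tendsto d (𝓝[>] 0) (𝓝 0) := by
    have h1 := h.initial (closedBall 0 1) (isCompact_closedBall _ _)
    exact tendsto_of_tendsto_of_tendsto_of_le_of_le tendsto_const_nhds h1 (fun t => bot_le)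
      fun t => lintegral_mono_set ball_subset_closedBall
  -- square roots
  set S : ℝ≥0∞ → ℝ≥0∞ := fun a => a ^ (1 / 2 : ℝ) with hS
  have hScont : Continuous S := ENNReal.continuous_rpow_const
  have hS2 : ∀ a : ℝ≥0∞, S a ^ (2 : ℝ) = a := fun a => by
    rw [hS, ← ENNReal.rpow_mul]; norm_num
  -- Minkowski on `B₁` at every `t > 0`
  have hv₀m : AEMeasurable (fun x => ‖v₀ x‖ₑ) μ := hv₀.restrict.enorm
  have hmink : ∀ t : ℝ, 0 < t → S (L t) ≤ S l + S (d t) ∧ S l ≤ S (L t) + S (d t) := by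
    intro t ht
    have hwm : AEStronglyMeasurable (w t) μ := (h.continuous_slice ht).aestronglyMeasurable
    have hdm : AEMeasurable (fun x => ‖w t x - v₀ x‖ₑ) μ := (hwm.sub hv₀.restrict).enorm
    have hdm' : AEMeasurable (fun x => ‖v₀ x - w t x‖ₑ) μ := (hv₀.restrict.sub hwm).enorm
    refine ⟨sqrt_lintegral_sq_le_add hv₀m hdm fun x => ?_, ?_⟩
    · calc ‖w t x‖ₑ = ‖v₀ x + (w t x - v₀ x)‖ₑ := by rw [add_sub_cancel]
        _ ≤ ‖v₀ x‖ₑ + ‖w t x - v₀ x‖ₑ := enorm_add_le _ _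
    · have h3 : d t = ∫⁻ x, ‖v₀ x - w t x‖ₑ ^ 2 ∂μ :=
        lintegral_congr fun x => by rw [enorm_sub_rev]
      rw [h3]
      refine sqrt_lintegral_sq_le_add hwm.enorm hdm' fun x => ?_
      calc ‖v₀ x‖ₑ = ‖w t x + (v₀ x - w t x)‖ₑ := by rw [add_sub_cancel]
        _ ≤ ‖w t x‖ₑ + ‖v₀ x - w t x‖ₑ := enorm_add_le _ _
  -- the square roots converge by squeezing
  have hSl : S l ≠ ⊤ := (ENNReal.rpow_lt_top_of_nonneg (by norm_num) hfin.ne).ne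
  have hSd : Tendsto (fun t => S (d t)) (𝓝[>] 0) (𝓝 0) := by
    have := (hScont.tendsto 0).comp hd0
    rwa [show S 0 = 0 from ENNReal.zero_rpow_of_pos (by norm_num)] at this
  have hlow : Tendsto (fun t => S l - S (d t)) (𝓝[>] 0) (𝓝 (S l)) := by
    have := ((ENNReal.continuous_sub_left hSl).tendsto 0).comp hSd
    rwa [tsub_zero] at this
  have hup : Tendsto (fun t => S l + S (d t)) (𝓝[>] 0) (𝓝 (S l)) := by
    have := tendsto_const_nhds.add hSd (f := fun _ : ℝ => S l)
    rwa [add_zero] at this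
  have hev : ∀ᶠ t in 𝓝[>] (0 : ℝ), 0 < t := self_mem_nhdsWithin
  have hSL : Tendsto (fun t => S (L t)) (𝓝[>] 0) (𝓝 (S l)) := by
    refine tendsto_of_tendsto_of_tendsto_of_le_of_le' hlow hup ?_ ?_
    · filter_upwards [hev] with t ht
      exact tsub_le_iff_right.2 (hmink t ht).2
    · filter_upwards [hev] with t ht
      exact (hmink t ht).1
  -- undo the square roots
  have hfin' := ((ENNReal.continuous_rpow_const (y := (2 : ℝ))).tendsto (S l)).comp hSL
  rw [hS2] at hfin'
  refine hfin'.congr fun t => ?_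
  exact hS2 (L t)

/-- **The weak gradient of an approximant is its classical gradient** on the slab `(0,∞) × ℝ³`
(smooth fields: the accepted `hasWeakSpatialGradientOn_of_contDiffOn`). [folklore] -/
theorem IsMollifiedApproximant.hasWeakSpatialGradientOn
    (h : IsMollifiedApproximant c ε η v₀ w ϖ) :
    HasWeakSpatialGradientOn (slab ℝ³ (Ioi 0) isOpen_Ioi) w fun t x => fderiv ℝ (w t) x :=
  hasWeakSpatialGradientOn_of_contDiffOn isOpen_Ioi (by rw [coe_slab])
    (h.smooth.of_le (by exact_mod_cast le_top))

end Consequences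

end BradshawTsai2019

/-! ## Part (a): [BT1]'s construction with its mollified approximants -/

/-- **Bradshaw–Tsai 2019, §3 (p. 8, p. 10) with [BT1]: the [BT1] solution is the limit of the
mollified scheme** (arXiv:1801.08060; [BT1] = Bradshaw–Tsai 2017, proof of Thm 2.4 and §4). Fix
`λ > 1` and the mollifier of [BT1] ("`η_ε(y) = ε⁻³η(y/ε)` for some `η ∈ C₀^∞` satisfying `∫η = 1`";
BT2019: "`η ∈ C₀^∞(ℝ³)`, is non-negative, and satisfies `∫η(y) dy = 1`"). For every divergence
free `λ`-DSS `v₀ ∈ L³_w(ℝ³)`: "`v` is a `λ`-DSS local Leray solution evolving from `v₀` constructed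
in [BT1] … and `π` is its associated pressure" ([BT1] Thm 1.2; `π(x,t) = p(y,s)/(2t)` with `p`
time periodic, [BT1] §4, so `π` is a `λ`-DSS pressure), `∇v` its weak gradient on `(0,∞) × ℝ³`;
"Since `v` is a solution from [BT1], its image under the similarity transform solves the
time-periodic Leray equations and is the limit of a mollified approximation scheme [BT1]. In
particular, for each `ε > 0`, there exists a time periodic solution `u_ε` to the problem (3.4) …
we obtain a `λ`-DSS vector field `v_ε` satisfying (3.5)" — along the sequence `ε = ε_k → 0` of
[BT1] ("there exists … a sequence `{U_{ε_k}}` of elements of `{U_ε}` so that … as `ε_k → 0`") the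
pairs `(v_{ε_k}, π_{ε_k})` are mollified approximants in the sense of
`BradshawTsai2019.IsMollifiedApproximant` (the printed properties of pp. 8–9, including the
energy class `v_ε ∈ L²(0,T;H¹(K))` of p. 8 and the pressure formula (3.8) of p. 9, derived there
for these approximants from "`w_ε ∈ L^∞(t₁,t₂;L²(ℝ³)) ∩ L²(t₁,t₂;L⁶(ℝ³))`", "`g ∈ L²([t₁,t₂];H⁻¹)`,
[CKN]", the uniqueness theorem for the non-stationary Stokes system "(see [BT1])" and the
normalisation "we can re-define `π_ε` to equal `π_ε − π_*(t)`") — and "By the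
convergence properties of `u_ε(y,s)` to `u(y,s) = √t v(x,t)` [BT1] and discretely self-similar
scaling …, for all `T > 0` and all compact sets `K ⊂ ℝ³`, `v_ε → v` weakly in `L²(0,T;H¹(K))`,
`v_ε → v` strongly in `L²(0,T;L²(K))`, `v_ε(s) → v(s)` weakly in `L²(K)` for all `s ∈ [0,T]`"
(p. 8), "`v_ε` converges weakly to `v` in `L²(1/k,T;H¹(B₁))` for every `k ∈ ℕ`" (p. 10), and
"`p_{ε_k} → p` weakly in `L^{5/3}(ℝ³ × [0,T])`" ([BT1], over one period, whence on every
`(t₁,t₂) ⊂ (0,∞)` by the scaling), rendered exactly as in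
`bradshawTsai2019_prop_3_1_approximation` (clause (iv): `v_ε(t) ⇀ v(t)` weakly in `L²(B_R)` for
every `t > 0`; `∂ₐv_ε ⇀ ∂ₐv` weakly in `L²((t₁,t₂) × B_R)`, the gradients of the approximants
being the classical ones; `π_ε ⇀ π` weakly in `L^{5/3}((t₁,t₂) × B_R)`). See the module docstring
("The class records BT2019's description of the scheme") for the relation of (3.4) to [BT1]'s
(2.3). **Not proved here.** [cite: BradshawTsai2019, §3 proof of Prop 3.1 (p. 8: (3.4)–(3.6) and the convergence list; p. 9: (3.8); p. 10); BradshawTsai2017AHP proof of Thm 2.4 and §4] -/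
def bradshawTsai2019_mollifiedScheme : Prop :=
  ∀ {c : ℝ}, 1 < c → ∃ η : ℝ³ → ℝ, ContDiff ℝ ∞ η ∧ HasCompactSupport η ∧ (∀ y, 0 ≤ η y) ∧
    ∫ y, η y = 1 ∧
    ∀ {v₀ : ℝ³ → ℝ³}, FunctionSpaces.MemWeakLp v₀ 3 volume → IsWeaklyDivFree v₀ →
      nsRescaleData c v₀ = v₀ →
    ∃ (v : ℝ → ℝ³ → ℝ³) (π : ℝ → ℝ³ → ℝ) (G : ℝ → ℝ³ → ℝ³ →L[ℝ] ℝ³),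
      -- the [BT1] solution, its pressure and its gradient
      IsLocalLeraySolution 1 v₀ v π ∧ IsDiscretelySelfSimilar c v ∧ nsRescalePressure c π = π ∧
      HasWeakSpatialGradientOn (slab ℝ³ (Ioi 0) isOpen_Ioi) v G ∧
      -- the scales `ε_k → 0` and the mollified approximants `v_{ε_k}`, `π_{ε_k}`
      ∃ (ε : ℕ → ℝ) (w : ℕ → ℝ → ℝ³ → ℝ³) (ϖ : ℕ → ℝ → ℝ³ → ℝ),
        (∀ k, 0 < ε k) ∧ Tendsto ε atTop (𝓝 0) ∧
        (∀ k, IsMollifiedApproximant c (ε k) η v₀ (w k) (ϖ k)) ∧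
        -- the convergence of the scheme:
        -- `v_ε(t) ⇀ v(t)` weakly in `L²(B_R)` for every `t > 0`, `R > 0`
        (∀ t : ℝ, 0 < t → ∀ R : ℝ, 0 < R →
          MemLp (v t) 2 (volume.restrict (ball (0 : ℝ³) R)) ∧
          (∀ k, MemLp (w k t) 2 (volume.restrict (ball (0 : ℝ³) R))) ∧
          ∀ φ : ℝ³ → ℝ³, MemLp φ 2 (volume.restrict (ball (0 : ℝ³) R)) →
            Tendsto (fun k => ∫ x in ball (0 : ℝ³) R, ⟪w k t x, φ x⟫) atTop
              (𝓝 (∫ x in ball (0 : ℝ³) R, ⟪v t x, φ x⟫))) ∧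
        -- `∂ₐv_ε ⇀ ∂ₐv` weakly in `L²((t₁,t₂) × B_R)`, `0 < t₁ < t₂`, `R > 0`, every direction `a`
        (∀ t₁ t₂ R : ℝ, 0 < t₁ → t₁ < t₂ → 0 < R → ∀ a : ℝ³,
          MemLp (fun z : ℝ × ℝ³ => G z.1 z.2 a) 2
            (volume.restrict (Ioo t₁ t₂ ×ˢ ball (0 : ℝ³) R)) ∧
          (∀ k, MemLp (fun z : ℝ × ℝ³ => fderiv ℝ (w k z.1) z.2 a) 2
            (volume.restrict (Ioo t₁ t₂ ×ˢ ball (0 : ℝ³) R))) ∧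
          ∀ φ : ℝ × ℝ³ → ℝ³, MemLp φ 2 (volume.restrict (Ioo t₁ t₂ ×ˢ ball (0 : ℝ³) R)) →
            Tendsto (fun k => ∫ z in Ioo t₁ t₂ ×ˢ ball (0 : ℝ³) R,
              ⟪fderiv ℝ (w k z.1) z.2 a, φ z⟫) atTop
              (𝓝 (∫ z in Ioo t₁ t₂ ×ˢ ball (0 : ℝ³) R, ⟪G z.1 z.2 a, φ z⟫))) ∧
        -- `π_ε ⇀ π` weakly in `L^{5/3}((t₁,t₂) × B_R)`, `0 < t₁ < t₂`, `R > 0`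
        (∀ t₁ t₂ R : ℝ, 0 < t₁ → t₁ < t₂ → 0 < R →
          MemLp (fun z : ℝ × ℝ³ => π z.1 z.2) (5 / 3 : ℝ≥0∞)
            (volume.restrict (Ioo t₁ t₂ ×ˢ ball (0 : ℝ³) R)) ∧
          (∀ k, MemLp (fun z : ℝ × ℝ³ => ϖ k z.1 z.2) (5 / 3 : ℝ≥0∞)
            (volume.restrict (Ioo t₁ t₂ ×ˢ ball (0 : ℝ³) R))) ∧
          ∀ ψ : ℝ × ℝ³ → ℝ,
            MemLp ψ (5 / 2 : ℝ≥0∞) (volume.restrict (Ioo t₁ t₂ ×ˢ ball (0 : ℝ³) R)) →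
            Tendsto (fun k => ∫ z in Ioo t₁ t₂ ×ˢ ball (0 : ℝ³) R, ϖ k z.1 z.2 * ψ z) atTop
              (𝓝 (∫ z in Ioo t₁ t₂ ×ˢ ball (0 : ℝ³) R, π z.1 z.2 * ψ z)))

/-! ## Part (b): the a priori estimate (3.12) and the pressure bound -/

/-- **Bradshaw–Tsai 2019, (3.12) and the pressure bound of p. 10: the a priori estimate for the
mollified approximants** (arXiv:1801.08060, pp. 8–10). Fix `λ > 1` and a mollifier `η`
(`C₀^∞`, non-negative, `∫η = 1`, "`supp η ⊂ B_ρ` for some `ρ > 0`"). "By taking `ε` sufficiently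
small we can ensure that, whenever `s < 1`, `supp η_{ε√s} ⊂ B_{λ−1}`" (p. 9): there is
`ε₀ = ε₀(λ, η) > 0`, and there is `C₀ = C(λ, η, γ)` ((3.12); `γ = γ(λ)` the absorption
parameter, "Provided `γ` is small enough, the gradient term can be absorbed into the left hand
side of (3.7)"), such that for `0 < ε ≤ ε₀`, every datum `v₀` as in Prop. 3.1 (divergence free,
`λ`-DSS, in `L³_w`; `α₀ = ‖v₀‖²_{L²(B_λ)}`) and every mollified approximant `(v_ε, π_ε)`
(`BradshawTsai2019.IsMollifiedApproximant λ ε η v₀ v_ε π_ε`: `λ`-DSS, smooth on `ℝ³ × (0,∞)`,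
solving (3.5), attaining `v₀` in `L²_loc`, in the energy class `L²(0,T;H¹(K))`, with pressure
given by (3.8) and `G, π_ε ∈ L²(t₁,t₂;L²)`), writing
`α_ε(t) = ∫_{B₁}|v_ε(x,t)|² dx`, `α̃_ε(t) = sup_{0≤τ≤t} α_ε(τ)`:
**(3.12)** "`α_ε(t) + ∫₀ᵗ∫_{B₁}|∇v_ε|² dx ds ≤ α₀ + C(λ,η,γ)∫₀ᵗ(α̃_ε(s)³ + α̃_ε(s)) ds`" for
`0 < t ≤ 1` ("We will estimate the terms on the right hand side of (3.7) for `0 < t ≤ 1`"; proof: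
the local energy equality (3.7) with `φ = χ²(|x|)χ(t)`, the scaling laws (3.6), Young and the
mollifier estimate (3.9), Gagliardo–Nirenberg (3.10)–(3.11), the pressure formula (3.8) with the
Calderón–Zygmund bound for `π_near` and the kernel bound for `π_far`, absorption of the gradient
terms — the proved `IsMollifiedApproximant.local_energy_eq`, `setLIntegral_cylinder_enorm_sq_le_of_dss`,
`exists_setLIntegral_unitCylinder_cube_le`, `exists_setLIntegral_cylinder_pressure_rpow_le` of
the sibling files); and the pressure bound: the three displayed `L^{3/2}(0,t;L^{3/2}(B_λ))` bounds of p. 10 by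
`C(λ,γ,η)∫₀ᵗ(α̃_ε³ + α̃_ε) ds + γ∫₀ᵗ∫|∇v_ε|²φ` together with
`∫₀ᵗ∫|∇v_ε|²φ ≤ α₀ + C∫₀ᵗ(α̃_ε³ + α̃_ε)` (the absorption step of (3.12)):
`∫₀ᵗ∫_{B₁}|π_ε|^{3/2} ≤ C₀(α₀ + ∫₀ᵗ(α̃_ε³ + α̃_ε) ds)`, `0 < t ≤ 1`
("`π_ε ∈ L^{3/2}(0,T;L^{3/2}(B₁))` with uniformly bounded norms", p. 10). The gradient is the
classical one of the smooth field; conventions (`ballEnergy`, `supBallEnergy`, lower Lebesgue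
integrals, `≤` for the printed bounds) are those of `bradshawTsai2019_prop_3_1_scheme`. **Not
proved here.** [cite: BradshawTsai2019, §3 proof of Prop 3.1 ((3.7)–(3.12) and the pressure bounds of p. 10)] -/
def bradshawTsai2019_apriori_3_12 : Prop :=
  ∀ {c : ℝ}, 1 < c → ∀ {η : ℝ³ → ℝ}, ContDiff ℝ ∞ η → HasCompactSupport η → (∀ y, 0 ≤ η y) →
    ∫ y, η y = 1 →
    ∃ ε₀ : ℝ, 0 < ε₀ ∧ ∃ C₀ : ℝ≥0, ∀ {ε : ℝ}, 0 < ε → ε ≤ ε₀ →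
      ∀ {v₀ : ℝ³ → ℝ³}, FunctionSpaces.MemWeakLp v₀ 3 volume → IsWeaklyDivFree v₀ →
        nsRescaleData c v₀ = v₀ →
      ∀ {w : ℝ → ℝ³ → ℝ³} {ϖ : ℝ → ℝ³ → ℝ}, IsMollifiedApproximant c ε η v₀ w ϖ →
        -- (3.12), `0 < t ≤ 1`
        (∀ t : ℝ, 0 < t → t ≤ 1 →
          ballEnergy w t +
              ∫⁻ z in Ioo 0 t ×ˢ ball (0 : ℝ³) 1,
                ENNReal.ofReal (frobeniusNormSq (fderiv ℝ (w z.1) z.2)) ≤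
            (∫⁻ x in ball (0 : ℝ³) c, ‖v₀ x‖ₑ ^ 2) +
              C₀ * ∫⁻ s in Ioo 0 t, (supBallEnergy w s ^ 3 + supBallEnergy w s)) ∧
        -- the pressure bound, `0 < t ≤ 1`
        (∀ t : ℝ, 0 < t → t ≤ 1 →
          ∫⁻ z in Ioo 0 t ×ˢ ball (0 : ℝ³) 1, ‖ϖ z.1 z.2‖ₑ ^ (3 / 2 : ℝ) ≤
            C₀ * ((∫⁻ x in ball (0 : ℝ³) c, ‖v₀ x‖ₑ ^ 2) +
              ∫⁻ s in Ioo 0 t, (supBallEnergy w s ^ 3 + supBallEnergy w s)))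

/-! ## The assembly: (a) + (b) ⟹ the approximation fact ⟹ Prop. 3.1 -/

/-- **Assembly of `bradshawTsai2019_prop_3_1_approximation` from its two printed ingredients**
(Bradshaw–Tsai 2019, §3, pp. 8–10): take the mollifier, the [BT1] solution, the scales `ε_k → 0`
and the approximants of (a); discard the finitely many `k` with `ε_k > ε₀(λ, η)` ("for `ε`
sufficiently small", p. 9) — the three convergences are unchanged along a tail —; clause (i) is
`continuousOn_ballEnergy`/`tendsto_ballEnergy` (p. 8; `v₀ ∈ L³_w ⊂ L²_loc`), the gradients are the
classical ones (`hasWeakSpatialGradientOn`), and clauses (ii)–(iii) are (b) quoted for each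
approximant with the constant `C₀ = C(λ, η, γ)`. [cite: BradshawTsai2019, §3 proof of Prop 3.1 (pp. 8–10)] -/
theorem bradshawTsai2019_prop_3_1_approximation_of_parts (hA : bradshawTsai2019_mollifiedScheme)
    (hB : bradshawTsai2019_apriori_3_12) : bradshawTsai2019_prop_3_1_approximation := by
  intro c hc
  obtain ⟨η, hηs, hηc, hη0, hη1, hAη⟩ := hA hc
  obtain ⟨ε₀, hε₀, C₀, hBη⟩ := hB hc hηs hηc hη0 hη1
  refine ⟨C₀, fun {v₀} hw hdiv hdss => ?_⟩
  obtain ⟨v, π, G, hLL, hdssv, hdssπ, hG, ε, w, ϖ, hεpos, hεlim, happ, hslice, hgrad, hpress⟩ :=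
    hAη hw hdiv hdss
  -- the tail `ε_k ≤ ε₀`
  obtain ⟨k₀, hk₀⟩ : ∃ k₀ : ℕ, ∀ k ≥ k₀, ε k ≤ ε₀ := by
    obtain ⟨k₀, hk₀⟩ := eventually_atTop.1 (hεlim.eventually (Iic_mem_nhds hε₀))
    exact ⟨k₀, hk₀⟩
  have hk : ∀ k, ε (k + k₀) ≤ ε₀ := fun k => hk₀ _ (Nat.le_add_left _ _)
  -- the datum has finite energy on the unit ball (`L³_w ⊂ L²_loc`)
  have h3 : (2 : ℝ) < (3 : ℝ≥0∞).toReal := by rw [ENNReal.toReal_ofNat]; norm_num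
  have hfin : ∫⁻ x in ball (0 : ℝ³) 1, ‖v₀ x‖ₑ ^ 2 < ⊤ :=
    hw.setLIntegral_enorm_sq_lt_top_of_two_lt h3 measure_ball_lt_top.ne
  have hB' := fun k => hBη (hεpos (k + k₀)) (hk k) hw hdiv hdss (happ (k + k₀))
  refine ⟨v, π, G, hLL, hdssv, hdssπ, hG, fun k => w (k + k₀), fun k => ϖ (k + k₀),
    fun k t x => fderiv ℝ (w (k + k₀) t) x,
    fun k => (happ (k + k₀)).continuousOn_ballEnergy,
    fun k => (happ (k + k₀)).tendsto_ballEnergy hw.aestronglyMeasurable hfin,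
    fun k => (happ (k + k₀)).hasWeakSpatialGradientOn,
    fun k => (hB' k).1, fun k => (hB' k).2, ?_, ?_, ?_⟩
  · intro t ht R hR
    obtain ⟨hv2, hw2, hweak⟩ := hslice t ht R hR
    exact ⟨hv2, fun k => hw2 (k + k₀), fun φ hφ =>
      (tendsto_add_atTop_iff_nat k₀).2 (hweak φ hφ)⟩
  · intro t₁ t₂ R ht₁ ht₁₂ hR a
    obtain ⟨hG2, hH2, hweak⟩ := hgrad t₁ t₂ R ht₁ ht₁₂ hR a
    exact ⟨hG2, fun k => hH2 (k + k₀), fun φ hφ =>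
      (tendsto_add_atTop_iff_nat k₀).2 (hweak φ hφ)⟩
  · intro t₁ t₂ R ht₁ ht₁₂ hR
    obtain ⟨hπ2, hϖ2, hweak⟩ := hpress t₁ t₂ R ht₁ ht₁₂ hR
    exact ⟨hπ2, fun k => hϖ2 (k + k₀), fun ψ hψ =>
      (tendsto_add_atTop_iff_nat k₀).2 (hweak ψ hψ)⟩

/-- **The scheme fact of `ForwardDSSLocalEnergy.lean` from (a) and (b)** (through the proved
passage to the limit `bradshawTsai2019_prop_3_1_scheme_of_approximation`). [cite: BradshawTsai2019, §3 proof of Prop 3.1 (pp. 8–10)] -/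
theorem bradshawTsai2019_prop_3_1_scheme_of_parts (hA : bradshawTsai2019_mollifiedScheme)
    (hB : bradshawTsai2019_apriori_3_12) : bradshawTsai2019_prop_3_1_scheme :=
  bradshawTsai2019_prop_3_1_scheme_of_approximation
    (bradshawTsai2019_prop_3_1_approximation_of_parts hA hB)

/-- **Prop. 3.1 with the DSS pressure clause from (a) and (b).** [cite: BradshawTsai2019, Prop 3.1 (proof pp. 8–10)] -/
theorem bradshawTsai2019_prop_3_1_dss_of_parts' (hA : bradshawTsai2019_mollifiedScheme)
    (hB : bradshawTsai2019_apriori_3_12) : bradshawTsai2019_prop_3_1_dss :=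
  bradshawTsai2019_prop_3_1_dss_of_approximation
    (bradshawTsai2019_prop_3_1_approximation_of_parts hA hB)

/-- **Prop. 3.1 as rendered in `ForwardDSSExistence.lean` from (a) and (b).** Hence the trust
base of `bradshawTsai2019_prop_3_1` (and of `bradshawTsai2019_prop_3_1_scheme`) in the tree is
`{bradshawTsai2019_mollifiedScheme, bradshawTsai2019_apriori_3_12}`. [cite: BradshawTsai2019, Prop 3.1 (proof pp. 8–10)] -/
theorem bradshawTsai2019_prop_3_1_of_parts' (hA : bradshawTsai2019_mollifiedScheme)
    (hB : bradshawTsai2019_apriori_3_12) : bradshawTsai2019_prop_3_1 :=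
  bradshawTsai2019_prop_3_1_of_approximation
    (bradshawTsai2019_prop_3_1_approximation_of_parts hA hB)

end Literature.Analysis.FluidPDE

end
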